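import Mathlib
import HarnessLib
import HarnessLib.Audit
import Summits.PneNP.Statement
import Literature.Computability.Complexity.Classes
import Literature.Computability.Complexity.Nondeterministic
import Literature.Computability.Complexity.NondeterministicProofs
import Literature.Computability.Complexity.GraphEncodings
import Literature.Computability.Complexity.ClayProblem
import Literature.Computability.Complexity.NPBridge
import Literature.Computability.Complexity.CNF
import Literature.Combinatorics.SimpleGraph.LovaszTheta
import Literature.Combinatorics.SimpleGraph.LasserreStableBound
import Literature.Computability.MetaComplexity.Resolution
import HarnessLib.Audit.Status.Attr

/-!
Route: RamseyUncertifiable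

DORMANT since 2026-08-24T12:34:57Z (reconciler: no traction for 6.8 d (last activity item-evidence-added at 2026-08-17T17:26:26Z); parked, not closed — `ledger route dormant route-PneNP-RamseyUncertifiable --off` to reactivate) — unstaffed, not closed; items shared with open routes are served there. `ledger route dormant <id> --off` reactivates.

# Route RamseyUncertifiable — Ramsey graphs cannot be certified — RAMSEY₂ ∉ NP, climbed by the
uncertainty principle las_t(G)·las_t(Ḡ) ≥ n^δ

It suffices to show X = RamseyNotNP (card PneNP/PneNP/ramsey-uncertifiable-sos-uncertainty): the
coNP language RAMSEY₂ of (codes of) n-vertex graphs G with ω(G) < ⌈2 log₂ n⌉ and α(G) < ⌈2 log₂ n⌉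
is NOT in NP — "Ramsey-ness has no polynomial-size certificates, for any verifier". RAMSEY₂ contains
almost every graph (Erdős 1947), is decidable in time n^{O(log n)} and hence is far below
coNP-completeness, yet RAMSEY₂ ∈ coNP ∧ RAMSEY₂ ∉ NP gives NP ≠ coNP and so P ≠ NP (support
RamseyInCoNP + the proved bridges; theorem `closes`). X is approached by an instance-independent
LADDER of proof systems whose rung 0 is a theorem (Lauria–Pudlák–Rödl–Thapen: EVERY graph needs
resolution length n^{Ω(log n)} for its binary Ramsey formula) and whose engine for semialgebraic
systems is the conjectured SoS UNCERTAINTY PRINCIPLE UP_t (support SosUncertainty — ladder rung, not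
a hypothesis of `closes`): las_t(G)·las_t(Ḡ) ≥ n^{δ_t} for every graph, Lovász's ϑ(G)ϑ(Ḡ) ≥ n being
the level-1 case.
Lean: `Literature.Computability.Complexity.encodingGraph.toLanguage {p : Σ n, SimpleGraph (Fin n) |
p.2.CliqueFree (Nat.clog 2 (p.1 ^ 2)) ∧ p.2ᶜ.CliqueFree (Nat.clog 2 (p.1 ^ 2))} ∉
Literature.Computability.Complexity.Nondeterministic.NP`

## Assembly
Pure logic over PROVED Literature facts (Sketch.lean, theorem `closes`, axioms
propext/choice/Quot.sound): if ¬PneNP then by the bridges `P_bool_eq_holds`, `np_bool_eq` we get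
Nondeterministic.NP ⊆ Classes.P, hence NP = P (`P_subset_NP_holds`) and coNP = co P = P = NP
(`co_P_holds`); then RamseyInCoNP puts RAMSEY₂ in NP, contradicting RamseyNotNP. The ladder
statements SosUncertainty, ResolutionUncertainty, PaleySosRung, RegularResolutionRung (ranks 2–5 at
open; re-badged crux → support on 2026-08-16 under the cone rule D-0027 §2.1 / glue.unused-crux)
calibrate and climb under X; none implies X and none follows from X (a lower bound for one proof
system vs. all verifiers) — the capture step is X itself, the single crux in the cone of `closes` (k
= 1: structurally this route is the proved bridge PneNP ⇐ RAMSEY₂ ∉ NP plus a thematic ladder).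

UNDER FLOOR: fewer than 2 cruxes remain after retriage (legacy route; D-0019).

Rationale: WHY THIS LINE. Cook–Reckhow routes (ProofCplx, Proofcplx) attack NP ≠ coNP through TAUT and strong
proof systems, where no candidate hard family is agreed; here ONE explicit coNP language of
quasi-polynomial deterministic complexity carries the separation, and its hard instances are forced
by TRUTH rather than by an ensemble: LauriaEtAl2016 (arXiv:1303.3166, Thm 3) prove that every
c-Ramsey graph needs resolution proofs of Ramsey-ness of length n^{Ω(log n)}, via the Prömel–Rödl
theorem that Ramsey graphs contain large random-like induced subgraphs (PromelRodl1999), and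
AtseriasEtAl2020 (arXiv:2012.09476, Thm 5.1 and §9) put the unary/regular case exactly at the
research frontier. The imported measuring device is real algebraic geometry / semidefinite
hierarchies: Laurent's Lasserre bound las_t (tree: `lasserreStableBound`, Laurent2006) and Lovász's
theta duality (Lovasz1979, Knuth1994; tree: `lovaszTheta`, `lovaszTheta_eq_min_topEigenvalue`,
`lasserreStableBound_one_eq_lovaszTheta`), read as an uncertainty principle between a graph and its
complement — degree-2 SoS cannot be near-tight on both G and Ḡ for ANY graph, and the crux bets this
persists with positive exponent at every constant level, which is what
BarakHopkinsKelnerKothariMoitraPotechin2019 (arXiv:1604.03084) prove for G(n,½) and KuniskyYu2022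
(arXiv:2211.02713) prove at degree 4 for the Paley graphs (number theory: the character-sum √p
barrier is literally the degree-2 line). Unlike PlantedClique / RamseyThreshold (average-case,
deterministic refuters, P-level conclusions) the object here is worst-case nondeterministic
certification of a fixed language and the conclusion is NP ≠ coNP; unlike RamseyAliens (the tally
function R(k,k)) it certifies given graphs. Catalogue used: duality / certificate-by-dual-witness
(SDP), structure-vs-randomness (Prömel–Rödl core), explicit algebraic test family (Paley); no
physical analogy.

RANKED CRUXES. RE-BADGE 2026-08-16 (route-repair, unused-crux): the only crux is #0 = X, the
deciding hypothesis of `closes` (k = 1, under the crux floor honestly: the route is a proved bridge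
plus a ladder — flagged for tenure/operator, not padded). The four ladder rungs below keep their
statements, decl names, evidence and Cruxes/ workfiles but are SUPPORT: each is a lower bound for
one proof system (resolution / constant-level Lasserre) on Ramsey formulas, logically independent of
X in both directions, so no glue `rung → X` can be filed honestly (it would be X in costume, and a
`low-degree/SoS-hard ⇒ uncertifiable` transfer is exactly what §Barriers disclaims); they were not
dropped because they are unique to this route (drop = moot, live crux chains stranded) and because
landed Theorems (RegularResolutionRung/Negative/OneSidedFalse: `regularResolutionRung_iff_restated`)
name a rung decl, so the decls must stay in this file. #0 RamseyNotNP (target, crux) — X — the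
language of adjacency codes of graphs on Fin n with no clique and no independent set of size ⌈2 log₂
n⌉ = Nat.clog 2 (n²) is not in NP. (why it might fail: a uniform poly-size certificate scheme for
Ramsey-ness of ALL graphs (an EF-formalised derandomised union bound, or extractor-style analyses
made to cover every graph) would put RAMSEY₂ in NP; today nothing below √n is certifiable even for
one Paley graph.) [arXiv:1303.3166, arXiv:2012.09476, Erdos1947, doi:10.1007/3-540-63248-4_8,
doi:10.1016/0020-0190(95)00209-x]
#2 SosUncertainty (support · ladder rung; crux at open, re-badged 2026-08-16: outside the cone of
`closes`, see RE-BADGE below) — UP_t (card K1): for every Lasserre level t ≥ 1 there are δ > 0 and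
n₀ such that every graph G on n ≥ n₀ vertices has las_t(G)·las_t(Ḡ) ≥ n^δ (las_t = Laurent's level-t
bound on the stability number, so las_t(Ḡ) relaxes ω(G)); level 1 is Lovász's ϑ(G)ϑ(Ḡ) ≥ n with δ =
1; consequence: no constant level of the Lasserre/SoS hierarchy certifies that ANY graph is even
n^{δ/2}-Ramsey. [difficulty: open-problem] (why it might fail: an explicit weakly-Ramsey family
(Frankl–Wilson, Grolmusz, extractor graphs) whose α,ω ≤ n^{o(1)} bounds are real-linear-algebra
arguments may be SoS-certifiable at a fixed level t ≥ 2 on BOTH sides, giving las_t(G)las_t(Ḡ) =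
n^{o(1)}; only t = 1 (all G) and G(n,½) (all t) are known.) [Lovasz1979, Laurent2006,
arXiv:1604.03084, arXiv:2211.02713, BarakHopkinsKelnerKothariMoitraPotechin2019]
#3 ResolutionUncertainty (support · ladder rung; crux at open, re-badged 2026-08-16: outside the
cone of `closes`, see RE-BADGE below) — LPRT one encoding up (card K2; the open problem of
LauriaEtAl2016 §1.1 and AtseriasEtAl2020 §9, general dag-like resolution): there are ε > 0 and n₀
such that for every graph G on n ≥ n₀ vertices and every pair of resolution refutations π₁ of the
UNARY clique formula Clique(G, ⌈2log₂n⌉) and π₂ of Clique(Ḡ, ⌈2log₂n⌉) (block variables x_{i,v} ↦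
i·n+v; clique-member, functionality and edge axioms as in AtseriasEtAl2020 §2), max(|π₁|,|π₂|) ≥
n^{ε log₂ n} — i.e. every 2-Ramsey graph needs quasi-polynomial resolution proofs of its Ramsey-ness
(vacuous for non-Ramsey G, where one formula is satisfiable). [difficulty: open-problem] (why it
might fail: dag-like resolution reuses lemmas: symmetric Ramsey graphs (Paley-type) might admit
n^{O(1)}·2^{O(k)} refutations, and even for G(n,½) general resolution at k ≈ 2log₂n is open
(size–width gives nothing: width-O(k) refutations exist); only regular resolution on average is
known.) [arXiv:1303.3166, arXiv:2012.09476, doi:10.1145/2499937.2499941, arXiv:2008.02138]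
#4 PaleySosRung (support · ladder rung; crux at open, re-badged 2026-08-16: outside the cone of
`closes`, see RE-BADGE below) — the explicit rung (card K3b): for every level t ≥ 1 there are η > 0
and p₀ such that for all primes p ≥ p₀ with p ≡ 1 (mod 4) the Paley graph P_p (x ~ y iff x − y is a
nonzero square in 𝔽_p) has las_t(P_p) ≥ p^η; P_p is self-complementary, so this is UP_t on the Paley
family (las_t(P_p)² ≥ p^δ); known: t = 1 (ϑ = √p), t = 2 (Kunisky–Yu, Ω(p^{1/3})); either ω(P_p) is
itself polynomial or constant-degree SoS cannot see that it is not. [deps: SosUncertainty]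
[difficulty: L] (why it might fail: Kunisky–Yu's numerics show degree 4 already beats √p (≈
p^{1/2−ε}) and pseudo-calibration provably does not transfer to P_p; some fixed level might certify
ω(P_p) ≤ p^{o(1)} — believed TRUE of ω (conjecture: polylog), only the SoS proof is missing.)
[arXiv:2211.02713, arXiv:2303.16475, Lovasz1979]
#5 RegularResolutionRung (support · ladder rung; crux at open, re-badged 2026-08-16: outside the
cone of `closes`, see RE-BADGE below) — the regular rung (AtseriasEtAl2020 §9, verbatim question,
instance-independent): as ResolutionUncertainty but for REGULAR resolution refutations π₁, π₂ (no
variable resolved twice on a path): max(|π₁|,|π₂|) ≥ n^{ε log₂ n} for every graph on n ≥ n₀ vertices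
at k = ⌈2log₂n⌉; known w.h.p. for G(n,½) (AtseriasEtAl2020 Thm 5.1 with ξ = (k−1)/(2log₂n)); the
missing step is that every Ramsey graph contains a large clique-dense induced subgraph (Prömel–Rödl
strengthened). [difficulty: M] (why it might fail: Ramsey graphs are less structured than G(n,½):
adding o(log n) isolated/twin vertices keeps Ramsey-ness but breaks clique-denseness
(AtseriasEtAl2020 §9), and the Prömel–Rödl core (size n^{3/4}, two-sided density δ) may be too weak
for the second clique-denseness property.) [arXiv:2012.09476, PromelRodl1999, arXiv:1303.3166]
#9 RamseyInCoNP (support) — RAMSEY₂ ∈ coNP: a non-member is a non-codeword (decidable in P) or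
carries a homogeneous ⌈2log₂n⌉-set as certificate (as for the tree's CLIQUE_mem_NP; closure of NP
under union with P-sets and FP-preimages). [difficulty: provable-now] [Karp1972, AroraBarak2009,
arXiv:1303.3166]
#9 ThetaUncertainty (support) — Lovász 1979 (Cor. to Thms 3–8): ϑ(G)·ϑ(Ḡ) ≥ n for every graph on n
vertices — UP at level 1 via `lasserreStableBound_one_eq_lovaszTheta`. Proof available in the tree's
language: take an optimal dual A for G (`exists_dual_of_lovaszTheta_eq`: A = J off E(G), ϑI − A ⪰
0); then B := (ϑI − A + J)/(nϑ) is theta-feasible for Ḡ with 𝟙ᵀB𝟙 ≥ n/ϑ. [difficulty: provable-now]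
[Lovasz1979, Knuth1994]
#9 RamseyAbundant (support) — Erdős 1947 at the exact threshold: for every n ≥ 3 some graph on Fin n
has neither a clique nor an independent set of size ⌈2log₂n⌉ (union bound: 2·C(n,k)·2^{−C(k,2)} ≤
2·2^{k/2}/k! < 1 for k = ⌈2log₂n⌉ ≥ 3); guarantees RAMSEY₂ is infinite, so X is not refutable by
finiteness. [difficulty: provable-now] [Erdos1947, arXiv:1303.3166]

TWO-LAYER PLAN. (After the re-badge the rungs are support items: the foreseen children below would
be filed as helper lemmas riding with `--supports <rung item>` or as further support statements, not
as glued crux splits.) Foreseen splits (filed only after a rung closes or by tenure), all of LPRT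
shape "pseudorandom core + hardness on the core": SosUncertainty ⇐ WeakRamseyCore → CoreSosHard →
SosUncertainty (WeakRamseyCore: every graph with α,ω < n^{δ₁} has an induced subgraph on m ≥ n^{δ₂}
vertices meeting explicit deterministic pseudorandomness conditions; CoreSosHard: those conditions
give las_t ≥ m^{δ₃} on both sides — the "derandomised BHKKMP" of Kunisky–Yu; glue = case split on
max(α,ω) ≥ n^{δ₁} plus monotonicity of las_t under induced subgraphs). RegularResolutionRung ⇐
RamseyCliqueDense → (AtseriasEtAl2020 Thm 6.x, known) → rung, and ResolutionUncertainty ⇐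
RamseyCliqueDense → CliqueDenseHardForResolution → crux, sharing the combinatorial child
RamseyCliqueDense (every Ramsey graph has an n^{Ω(1)}-vertex clique-dense induced subgraph).

KILL CRITERIA. RamseyNotNP refuted (a certificate scheme putting RAMSEY₂ in NP) closes the route
`refuted:RamseyNotNP` — and is itself a landmark (nondeterministic certification below √n).
SosUncertainty refuted at some level t₀ by a family G_n: the mechanism dies but X does not — restate
UP for vertex-transitive / pseudorandom-core graphs or demote the SoS line below the resolution
rungs; if the refuting family consists of genuine 2-Ramsey graphs with SoS-certified Ramsey-ness,
record it as evidence that certifiability tracks "explicitness" and re-rank ResolutionUncertainty to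
2. ResolutionUncertainty refuted (an infinite family of Ramsey graphs with n^{o(log n)} unary
resolution proofs) answers AtseriasEtAl2020 §9 negatively — restate to G(n,½) a.a.s. or close
`exhausted` if RegularResolutionRung also falls. NP = coNP proved anywhere moots the route;
RamseyAbundant refuted (impossible barring an error in the threshold) would make X false by
finiteness — restate the threshold.

NOT DECOMPOSED YET. The quantitative exponent δ_t ≥ κ/t (which would force SoS degree Ω(log n/log
log n), matching brute force) — a strengthening of SosUncertainty, filed only once UP_2 is settled;
rungs for Res(log), polynomial calculus, cutting planes and unary Sherali–Adams (average case: de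
Rezende–Potechin–Risse arXiv:2404.16722) — need size measures the tree lacks; the binary encoding
(LPRT's own, a theorem) as a cite fact; the Paley resolution rung at k ≈ √p and the EF upper-bound
calibration (poly-size EF proofs of ω(P_p) ≤ √p + 1 via Gauss sums); the dependence on c in c·log₂n
(c = 2 fixed here: the Erdős threshold, where the language has density → 1).

CHEAPEST FALSIFIER. Level-2 Lasserre SDPs (moment matrices of order 1 + n + C(n,2) ≤ 1.3·10³ for n ≤
50) for both G and Ḡ over: Paley P_q (q = 13 … 49), 20 samples of G(n,½) (n = 30, 40, 50), the small
Frankl–Wilson / Kneser-type intersection graphs and the strongly regular graphs with small α·ω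
(Clebsch, Schläfli, Hoffman–Singleton complements); plot log(las_2(G)·las_2(Ḡ))/log n. A family
trending to exponent 0 kills SosUncertainty at t = 2 before any prover touches it. Not run by this
seat (compute-free hub; recommended as the refuter's first kit job). Lookup falsifier already run:
no printed level-≥2 product inequality or counterexample found (searches in § Novelty).

NUMBERS. ϑ(G)ϑ(Ḡ) ≥ n, with equality for vertex-transitive G (Lovasz1979); ϑ(P_p) = √p. G(n,½): ω ≈
2log₂n − 2log₂log₂n (Erdos1947: no homogeneous 2log₂n-set w.h.p.); degree-d SoS clique value ≥
n^{1/2 − c(d/log n)^{1/2}} w.h.p. (arXiv:1604.03084). Paley: ω(P_p) ≤ √p (Hoffman/trivial), ≤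
(√(2p−1)+1)/2 (Hanson–Petridis, via arXiv:2303.16475 Thm 1.2), conjectured polylog p; degree-4 SoS
value ≥ Ω(p^{1/3}), numerically ≈ p^{1/2−ε} (arXiv:2211.02713, abstract). Resolution: L(Ram_G) ≥
n^{Ω(log n)} binary, every graph, tight n^{Θ(log n)} for c-Ramsey G (arXiv:1303.3166 Thm 3, Prop 2);
unary: treelike n^{Ω(log n)} (ibid. Thm 4), regular n^{Ω(log² n/k)} w.h.p. for G(n,½)
(arXiv:2012.09476 Thm 5.1), general dag-like open. RAMSEY₂ ∈ DTIME(n^{O(log n)}). Items at open: 10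
(target, assembly, 4 cruxes, 3 supports + closes); after the 2026-08-16 re-badge: 1 crux (X), 7
supports (3 proved), assembly (proved), closes (proved).

DEFINITION REQUESTS. None required (all statements elaborate over existing declarations:
`lasserreStableBound`, `lovaszTheta`, `encodingGraph.toLanguage`, `Nondeterministic.NP`, `coNP`,
`IsResRefutation`, `IsRegular`, Mathlib `SimpleGraph.CliqueFree`, `Nat.clog`, `SimpleGraph.fromRel`,
`IsSquare`). Convenience definitions that would shorten three items and serve sibling cards
(karp-factor-two-clique, resolution-automatability-ladder, paley-square-root-barrier):
`cliqueFormula G k : CNF ℕ` (the unary Clique(G,k) of Beame–Impagliazzo–Sabharwal / AtseriasEtAl2020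
§2, next to `pigeonholeCNF`) and `paleyGraph p` — to be requested by tenure if a prover asks. Cite
facts worth vendoring as calibration: LPRT Thm 3 (binary, every graph) and AtseriasEtAl2020 Thm 5.1.

Novelty: Searches (2026-08-15): `lit search --source crossref` ×3 ("Kunisky Yu degree sum-of-squares Paley
clique" → KY22, Kunisky 2024, MPW15, BHKKMP16, HKP; "Lovász theta complement product Lasserre
hierarchy higher level inequality" → 10 rows, none relevant beyond Gärtner–Matoušek and
Galli–Letchford on ϑ variants; "proving that a graph is Ramsey proof complexity certification coNP"
→ LPRT ×2, Krajíček NP∩coNP generators 2026, Carlucci–Galesi–Lauria off-diagonal Ramsey, Schaefer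
1999, LIPTON 1996); `lit galaxy search --star all "Ramsey graph"` (21 rows: extractor/disperser
constructions BRSW, Li-type, Gamarnik RIP-is-Ramsey-hard — constructions, not certification),
`--star all "no large clique"` (16 rows → Krajíček 1995 §14.2 read via `lit galaxy read
panama:332267259953240 --chars 735500-741500`: clique tautologies A_H at k = n^ε, Thm 14.2.3),
`--star pdf "Ramsey graphs"` (15), `--star pdf "clique number of the Paley graph"` (0); `lit
frontier PneNP --since 2022` (30 rows, none on Ramsey certification); `lit read` arXiv:1303.3166 pp.
4–7, 9; arXiv:2012.09476 pp. 3–5, 13, 24; arXiv:2211.02713 pp. 1–3; searchd hybrid/vsearch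
unavailable (rc 75) all session, OpenAlex/S2 rate-limited; Lipton 1996 paywalled (acq-02694 filed).
Nearest prior art found: arXiv:1303.3166 (LPRT: instance-independent resolution bound, binary — the
template, rung 0); arXiv:2012.09476 §9 (asks cruxes 3 and 5 as open questions — those rungs are
KNOWN OPEN PROBLEMS, claimed as such, not as new); Lovasz1979 (UP at  [refs: 10.1016/0020-0190(95, 10.1007/3-540-63248-4_8, 1303.3166, 2012.09476, 2211.02713, 2303.16475, doi:10.1016/0020-0190, doi:10.1007/3-540-63248-4_8, Lovasz1979]

Barriers (technique_class: proof-complexity, sos-lower-bounds, instance-independence): - technique_class: proof-complexity, sos-lower-bounds, instance-independence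
- Literature.Barriers.PneNP.Relativization: X ⇒ NP ≠ coNP fails relative to oracles, so whatever
finally proves X is non-relativizing; it does not evade at the top — the bet is that X is climbed
rung by rung with proof-system-specific combinatorics (width games, pseudo-expectations, character
sums) that have no oracle slot, and no relativizing argument is filed.
- Literature.Barriers.PneNP.BoundedRelativization: same concession as Relativization (the collapsing
oracle is in PSPACE); same bet.
- Literature.Barriers.PneNP.Algebrization: same concession for the final step; none of the rungs is
an arithmetisation argument.
- Literature.Barriers.PneNP.NaturalProofs: not engaged — no circuit lower bound is claimed (the
conclusion is NP ≠ coNP ⇒ P ≠ NP); the truth-table analogue of X is Rudich's demi-bit conjecture,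
which Razborov–Rudich does not obstruct.
- Literature.Barriers.PneNP.NaturalProofsTC0: not engaged, as above.
- Literature.Barriers.PneNP.LowDegreeCounterexamples: applies as a caution and is built in —
algebraic structure (subfields: ω(P_{p²}) = p) is where moment heuristics mispredict, so UP is
stated for ALL graphs, PaleySosRung is the algebraic test case, and no "low-degree ⇒ P" transfer is
used anywhere.
- Literature.Barriers.PneNP.LatticeGapCoNP: the Aharonov–Regev pattern (membership in a small class
forbids hardness) applies to the SHAPE of X: RAMSEY₂ ∈ DTIME(n^{O(log n)}), so X can neve

Novelty grade: new-combination — ROUTE REVIEW (refuter rreview-0815T14-7, 2026-08-15; file REVIEW-RamseyUncertifiable.md on stmt-PneNP-9822). Grade new-combination: LPRT's instance-independent proof-complexity template for Ramsey-ness joined with the Lovász/Laurent SoS hierarchy read as a G–Ḡ uncertainty principle; cruxes 9816/9818 (refuter refuter-rreview-0815T14-7-0, 2026-08-15T15:12:07Z; prior: arXiv:1303.3166 (LPRT: instance-independent resolution bound, the template), arXiv:2012.09476 §9 (cruxes 9816/9818 posed verbatim as open), Lovasz1979 Cor.2/Thm 8 (UP at t=1), Laurent2006 (las_t), arXiv:1604.03084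 (BHKKMP, G(n,1/2) all t), arXiv:2211.02713 (Kunisky–Yu, Paley t=2), Kauers–O'Donnell–Tan–Zhou SODA2014 (SoS certifies Frankl–Rödl: nearest 'SoS captures a polynomial-method bound', does )

History (route lifecycle, newest last):
- 2026-08-16T04:14:40Z · AUTO-CRUX (backfill): RamseyNotNP — hypotheses of the deciding theorem that nothing in the route derives are cruxes (operator:999:1085951)
- 2026-08-24T12:34:57Z · DORMANT — reconciler: no traction for 6.8 d (last activity item-evidence-added at 2026-08-17T17:26:26Z); parked, not closed — `ledger route dormant route-PneNP-RamseyUnce (operator:999:1720488)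

sub-problem: PneNP · status: dormant · opened planner-plancard-PneNP-PneNP-ramsey-uncertifi-5aa76b43-0 2026-08-15T14:30:22Z · rev 5 · ledger route-PneNP-RamseyUncertifiable
GENERATED by the gate from the ledger (D-0016/17). Provers cite these decls: `theorem foo : Summit.PneNP.PneNP.Theses.RamseyUncertifiable.<Decl> := …` in Summits/PneNP/PneNP/Theorems/<Name>.lean.
-/

namespace Summit.PneNP.PneNP.Theses.RamseyUncertifiable

open scoped BigOperators Topology Manifold Classical MeasureTheory ProbabilityTheory Matrix InnerProductSpace ComplexConjugate ContinuousMap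
open Filter Set Function TopologicalSpace MeasureTheory

attribute [summit_statement] _root_.PneNP

open Literature.PNP

/-- item stmt-PneNP-9814 · crux (kind.auto-crux: conjecture-grade) · rank 0 · open · by planner
why it might fail: X ⟹ NP ≠ coNP, so X is false if NP = coNP; even with NP ≠ coNP, RAMSEY₂ could lie in NP ∩ coNP via a certificate scheme special to Ramsey-ness (derandomised union bound in EF, extractor-style analyses). Calibration: no ω(P_p) ≤ p^{1/2−ε} is provable today even for Paley graphs (HP21 ≈ 0.71√p).
sources: arXiv:1303.3166, arXiv:2012.09476, Rudich1997, doi:10.1016/0020-0190(95)00209-x, HansonPetridis2020, Erdos1947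
[target] X — the language of adjacency codes of graphs on Fin n with no clique and no independent
set of size ⌈2 log₂ n⌉ = Nat.clog 2 (n²) is not in NP. -/
@[route_item "route-PneNP-RamseyUncertifiable", crux]
def RamseyNotNP : Prop :=
  Literature.Computability.Complexity.encodingGraph.toLanguage {p : Σ n, SimpleGraph (Fin n) | p.2.CliqueFree (Nat.clog 2 (p.1 ^ 2)) ∧ p.2ᶜ.CliqueFree (Nat.clog 2 (p.1 ^ 2))} ∉ Literature.Computability.Complexity.Nondeterministic.NP

/-- item stmt-PneNP-9815 · support · rank 2 · open · by planner
why it might fail: Fails iff some explicit n^{o(1)}-Ramsey family (Frankl–Wilson/Grolmusz polynomial-method graphs, extractor-based graphs) has α AND ω certified ≤ n^{o(1)} by constant-level Lasserre — unknown either way; proved only at t = 1 (Lovász, all G), for G(n,½) at all t (BHKKMP) and for Paley at t = 2 (KY22).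
sources: Lovasz1979, Laurent2006, arXiv:1604.03084, arXiv:2211.02713, doi:10.1007/BF02579457
[crux] UP_t (card K1): for every Lasserre level t ≥ 1 there are δ > 0 and n₀ such that every graph G
on n ≥ n₀ vertices has las_t(G)·las_t(Ḡ) ≥ n^δ (las_t = Laurent's level-t bound on the stability
number, so las_t(Ḡ) relaxes ω(G)); level 1 is Lovász's ϑ(G)ϑ(Ḡ) ≥ n with δ = 1; consequence: no
constant level of the Lasserre/SoS hierarchy certifies that ANY graph is even n^{δ/2}-Ramsey.
[difficulty: open-problem] -/
@[route_item "route-PneNP-RamseyUncertifiable"]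
def SosUncertainty : Prop :=
  ∀ t : ℕ, 1 ≤ t → ∃ δ : ℝ, 0 < δ ∧ ∃ n₀ : ℕ, ∀ n ≥ n₀, ∀ G : SimpleGraph (Fin n), (n : ℝ) ^ δ ≤ Literature.Combinatorics.SimpleGraph.lasserreStableBound G t * Literature.Combinatorics.SimpleGraph.lasserreStableBound Gᶜ t

/-- item stmt-PneNP-9816 · support · rank 3 · open · by planner
why it might fail: Even a worst-case n^{Ω(k)} (or any n^{ω(1)} at k ≈ 2log₂n) resolution bound for UNARY clique formulas is a long-standing open problem (BGLR12; OWR 15/2024): dag-like proofs may reuse lemmas on symmetric Ramsey graphs; size–width gives nothing; known: tree-like, regular avg-case, k ≥ n^{Ω(1)} (Pang).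
sources: arXiv:1303.3166, arXiv:2012.09476, doi:10.1145/2499937.2499941, doi:10.1145/2355580.2355582, doi:10.1007/978-3-030-79416-3_22, doi:10.1007/s00037-007-0230-0
[crux] LPRT one encoding up (card K2; the open problem of LauriaEtAl2016 §1.1 and AtseriasEtAl2020
§9, general dag-like resolution): there are ε > 0 and n₀ such that for every graph G on n ≥ n₀
vertices and every pair of resolution refutations π₁ of the UNARY clique formula Clique(G, ⌈2log₂n⌉)
and π₂ of Clique(Ḡ, ⌈2log₂n⌉) (block variables x_{i,v} ↦ i·n+v; clique-member, functionality and
edge axioms as in AtseriasEtAl2020 §2), max(|π₁|,|π₂|) ≥ n^{ε log₂ n} — i.e. every 2-Ramsey graph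
needs quasi-polynomial resolution proofs of its Ramsey-ness (vacuous for non-Ramsey G, where one
formula is satisfiable). [difficulty: open-problem] -/
@[route_item "route-PneNP-RamseyUncertifiable"]
def ResolutionUncertainty : Prop :=
  ∃ ε : ℝ, 0 < ε ∧ ∃ n₀ : ℕ, ∀ n ≥ n₀, ∀ (G : SimpleGraph (Fin n)) [DecidableRel G.Adj], let k := Nat.clog 2 (n ^ 2); let cnf : (Fin n → Fin n → Bool) → Literature.Computability.Complexity.CNF ℕ := fun adj => ((List.range k).map fun i => (List.finRange n).map fun v => (i * n + (v : ℕ), true)) ++ ((List.range k).flatMap fun i => (List.finRange n).flatMap fun u => (List.finRange n).flatMap fun v => if u < v then [[(i * n + (u : ℕ), false), (i * n + (v : ℕ), false)]] else []) ++ ((List.range k).flatMap fun i => (List.range k).flatMap fun j => (List.finRange n).flatMap fun u => (List.finRange n).flatMap fun v => if i ≠ j ∧ adj u v = false then [[(i * n + (u : ℕ), false), (j * n + (v : ℕ), false)]] else []); ∀ π₁ π₂ : List (Literature.Computability.MetaComplexity.ResLine ℕ), Literature.Computability.MetaComplexity.IsResRefutation (cnf fun u v => decide (G.Adj u v)) π₁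 → Literature.Computability.MetaComplexity.IsResRefutation (cnf fun u v => decide (Gᶜ.Adj u v)) π₂ → (n : ℝ) ^ (ε * Real.logb 2 n) ≤ max (π₁.length : ℝ) (π₂.length : ℝ)

/-- item stmt-PneNP-9817 · support · rank 4 · closed · proved by Summit.PneNP.PneNP.Theorems.PaleySosRungWeilPatch.paleySosRung_proof @ 234c9b5f1db3 (prover) · by planner
why it might fail: Nothing known for t ≥ 3; t = 2 is only Ω(p^{1/3}) vs numerics ≈ p^{0.456} (L2 ≥ SOS-4, p < 1000): a fixed level might certify ω(P_p) ≤ p^{o(1)} — a bound believed TRUE (ω(P_p) conjectured polylog), only its low-degree SoS provability is open; pseudo-calibration does not directly transfer (KY22).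
sources: arXiv:2211.02713, arXiv:2304.08615, arXiv:2303.16475, HansonPetridis2020, Lovasz1979
[crux] the explicit rung (card K3b): for every level t ≥ 1 there are η > 0 and p₀ such that for all
primes p ≥ p₀ with p ≡ 1 (mod 4) the Paley graph P_p (x ~ y iff x − y is a nonzero square in 𝔽_p)
has las_t(P_p) ≥ p^η; P_p is self-complementary, so this is UP_t on the Paley family (las_t(P_p)² ≥
p^δ); known: t = 1 (ϑ = √p), t = 2 (Kunisky–Yu, Ω(p^{1/3})); either ω(P_p) is itself polynomial or
constant-degree SoS cannot see that it is not. [deps: SosUncertainty] [difficulty: L] -/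
@[route_item "route-PneNP-RamseyUncertifiable"]
def PaleySosRung : Prop :=
  ∀ t : ℕ, 1 ≤ t → ∃ η : ℝ, 0 < η ∧ ∃ p₀ : ℕ, ∀ p ≥ p₀, p.Prime → p % 4 = 1 → (p : ℝ) ^ η ≤ Literature.Combinatorics.SimpleGraph.lasserreStableBound (SimpleGraph.fromRel fun x y : Fin p => IsSquare (x - y)) t

/-- item stmt-PneNP-9818 · support · rank 5 · open · by planner
why it might fail: Asked verbatim in ABdRLNR21's concluding remarks: the bound needs both clique-denseness properties; Ramsey graphs are less structured than G(n,½) — a few isolated vertices keep Ramsey-ness but kill property 1 (fixable via Prömel–Rödl as in LPRT); property 2 "seems significantly more challenging".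
sources: arXiv:2012.09476, PromelRodl1999, arXiv:1303.3166
[crux] the regular rung (AtseriasEtAl2020 §9, verbatim question, instance-independent): as
ResolutionUncertainty but for REGULAR resolution refutations π₁, π₂ (no variable resolved twice on a
path): max(|π₁|,|π₂|) ≥ n^{ε log₂ n} for every graph on n ≥ n₀ vertices at k = ⌈2log₂n⌉; known
w.h.p. for G(n,½) (AtseriasEtAl2020 Thm 5.1 with ξ = (k−1)/(2log₂n)); the missing step is that every
Ramsey graph contains a large clique-dense induced subgraph (Prömel–Rödl strengthened). [difficulty:
M] -/
@[route_item "route-PneNP-RamseyUncertifiable"]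
def RegularResolutionRung : Prop :=
  ∃ ε : ℝ, 0 < ε ∧ ∃ n₀ : ℕ, ∀ n ≥ n₀, ∀ (G : SimpleGraph (Fin n)) [DecidableRel G.Adj], let k := Nat.clog 2 (n ^ 2); let cnf : (Fin n → Fin n → Bool) → Literature.Computability.Complexity.CNF ℕ := fun adj => ((List.range k).map fun i => (List.finRange n).map fun v => (i * n + (v : ℕ), true)) ++ ((List.range k).flatMap fun i => (List.finRange n).flatMap fun u => (List.finRange n).flatMap fun v => if u < v then [[(i * n + (u : ℕ), false), (i * n + (v : ℕ), false)]] else []) ++ ((List.range k).flatMap fun i => (List.range k).flatMap fun j => (List.finRange n).flatMap fun u => (List.finRange n).flatMap fun v => if i ≠ j ∧ adj u v = false then [[(i * n + (u : ℕ), false), (j * n + (v : ℕ), false)]] else []); ∀ π₁ π₂ : List (Literature.Computability.MetaComplexity.ResLine ℕ), Literature.Computability.MetaComplexity.IsResRefutation (cnf fun u v => decide (G.Adj u v)) π₁ → Literature.Computability.MetaComplexity.IsRegular π₁ → Literature.Computability.MetaComplexity.IsResRefutation (cnf fun u v => decide (Gᶜ.Adj u v)) π₂ → Literature.Computability.MetaComplexity.IsRegular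 π₂ → (n : ℝ) ^ (ε * Real.logb 2 n) ≤ max (π₁.length : ℝ) (π₂.length : ℝ)

/-- item stmt-PneNP-9819 · support · rank 9 · closed · proved by Summit.PneNP.PneNP.Theorems.ramseyInCoNP_proof (prover) · by planner
sources: Karp1972, AroraBarak2009, arXiv:1303.3166
[support] RAMSEY₂ ∈ coNP: a non-member is a non-codeword (decidable in P) or carries a homogeneous
⌈2log₂n⌉-set as certificate (as for the tree's CLIQUE_mem_NP; closure of NP under union with P-sets
and FP-preimages). [difficulty: provable-now] -/
@[route_item "route-PneNP-RamseyUncertifiable", crux]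
def RamseyInCoNP : Prop :=
  Literature.Computability.Complexity.encodingGraph.toLanguage {p : Σ n, SimpleGraph (Fin n) | p.2.CliqueFree (Nat.clog 2 (p.1 ^ 2)) ∧ p.2ᶜ.CliqueFree (Nat.clog 2 (p.1 ^ 2))} ∈ Literature.Computability.Complexity.coNP

/-- item stmt-PneNP-9820 · support · rank 9 · closed · proved by Summit.PneNP.PneNP.Theorems.thetaUncertainty_proof @ 463b36317c39 (prover) · by planner
sources: Lovasz1979, Knuth1994
[support] Lovász 1979 (Cor. to Thms 3–8): ϑ(G)·ϑ(Ḡ) ≥ n for every graph on n vertices — UP at level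
1 via `lasserreStableBound_one_eq_lovaszTheta`. Proof available in the tree's language: take an
optimal dual A for G (`exists_dual_of_lovaszTheta_eq`: A = J off E(G), ϑI − A ⪰ 0); then B := (ϑI −
A + J)/(nϑ) is theta-feasible for Ḡ with 𝟙ᵀB𝟙 ≥ n/ϑ. [difficulty: provable-now] -/
@[route_item "route-PneNP-RamseyUncertifiable"]
def ThetaUncertainty : Prop :=
  ∀ n : ℕ, ∀ G : SimpleGraph (Fin n), (n : ℝ) ≤ Literature.Combinatorics.SimpleGraph.lovaszTheta G * Literature.Combinatorics.SimpleGraph.lovaszTheta Gᶜ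

/-- item stmt-PneNP-9821 · support · rank 9 · closed · proved by Summit.PneNP.PneNP.Theorems.ramseyAbundant_proof (prover) · by planner
sources: Erdos1947, arXiv:1303.3166
[support] Erdős 1947 at the exact threshold: for every n ≥ 3 some graph on Fin n has neither a
clique nor an independent set of size ⌈2log₂n⌉ (union bound: 2·C(n,k)·2^{−C(k,2)} ≤ 2·2^{k/2}/k! < 1
for k = ⌈2log₂n⌉ ≥ 3); guarantees RAMSEY₂ is infinite, so X is not refutable by finiteness.
[difficulty: provable-now] -/
@[route_item "route-PneNP-RamseyUncertifiable"]
def RamseyAbundant : Prop :=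
  ∀ n : ℕ, 3 ≤ n → ∃ G : SimpleGraph (Fin n), G.CliqueFree (Nat.clog 2 (n ^ 2)) ∧ Gᶜ.CliqueFree (Nat.clog 2 (n ^ 2))

/-- item stmt-PneNP-9822 · assembly · rank 1 · closed · proved by Summit.PneNP.PneNP.Theorems.ramseyUncertifiable_assembly_proof @ cf29ad9b5131 (prover) · by planner
sources: CookReckhow1979, AroraBarak2009
[assembly] RamseyNotNP → RamseyInCoNP → PneNP. -/
@[route_item "route-PneNP-RamseyUncertifiable"]
def Assembly : Prop :=
  RamseyNotNP → RamseyInCoNP → PneNP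

/-! D-0027 §2.1 — DECIDING THEOREM (planner-authored via `route open/edit --closes-file`; by planner-rrepair-PneNP-RamseyUncertifiable-86d48bfa-g2-0 2026-08-15T16:10:41Z):
its hypotheses are this route's items and its conclusion the sub-problem Statement (glue_lint), and it elaborates with this file. -/

@[closes "route-PneNP-RamseyUncertifiable"] theorem closes (hX : RamseyNotNP) (hco : RamseyInCoNP) : PneNP := by
  by_contra h
  have hP : Literature.Computability.Complexity.PNPWave0.P Bool = Literature.Computability.Complexity.Classes.P :=
    Literature.Computability.Complexity.P_bool_eq_holds
  have hN : Literature.Computability.Complexity.PNPWave0.NP Bool = Literature.Computability.Complexity.Nondeterministic.NP :=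
    Literature.Computability.Complexity.np_bool_eq
  have hsub : Literature.Computability.Complexity.Nondeterministic.NP ⊆ Literature.Computability.Complexity.Classes.P := by
    intro L hL
    by_contra hL'
    exact h ⟨L, hN ▸ hL, hP ▸ hL'⟩
  have heq : Literature.Computability.Complexity.Nondeterministic.NP = Literature.Computability.Complexity.Classes.P :=
    Set.Subset.antisymm hsub Literature.Computability.Complexity.P_subset_NP_holds
  have hco' : Literature.Computability.Complexity.coNP = Literature.Computability.Complexity.Nondeterministic.NP := by
    show Literature.Computability.Complexity.co Literature.Computability.Complexity.Nondeterministic.NP = Literature.Computability.Complexity.Nondeterministic.NP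
    rw [heq]
    exact Literature.Computability.Complexity.co_P_holds
  exact hX (hco' ▸ hco)

end Summit.PneNP.PneNP.Theses.RamseyUncertifiable
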